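import Literature.NumberTheory.Rogawski1990.ArchTorusOrbitalCompactWallLimitsGlobal  -- ★ LH3-p04 (g2) brick A p849649 (brings (C-bdry-glob), J1's transport, ★ (J-cw), ★ (C-cw), ★ `ArchLocalRelabelTransport`)
import Literature.NumberTheory.Rogawski1990.ArchGlobalStableOrbitalWallDeriv        -- ★ (δ) F0P3a-p07: Fubini reduction to one place, `exists_contDiff_partialOrbital_eq`
import HarnessLib

/-!
# (C-cw)∕(J-cw) GLOBAL, BARE ORBITAL FUNCTION: `∫_{G′_∞} Θ(↑↑(g·t((z^ψ)∘ρ)·g⁻¹)) dν_∞` and its `ψ`-derivative have two-sided limits at a COMPACT wall (no `2 sin ψ` factor)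
# (Rogawski 1990 §8.2 p. 123 «−2cF′(γ₀′)»; Varadarajan 1989 §6.4; Borel–Jacquet §4.1)

Topic `NumberTheory/Rogawski1990`; namespace `Literature.NumberTheory.Rogawski1990`.  THEOREMS ONLY (no `def`, no instance, no notation, no axiom, no named fact, no `sorry`).
Cell `pub/hodgecm-mathlib`, line LH3 (closer stub `stub_N9`, crux H413 = `stmt-HodgeConjecture-24833`), organs (M2-def)∕(M3-def) «at a DEFINITE place the Δ″-side is smooth across every wall» (D2′-SPEC §3), brick C: the BARE-function twin of ★ brick A p849649
`ArchTorusOrbitalCompactWallLimitsGlobal` — at a compact wall the orbital function ITSELF (not only `2 sin ψ ·` it) is `C¹` through the wall parameter (★ (J-cw)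
`contDiffOn_one_integral_comp_conj_splitCurve_compactWall` on the open block-separated set `∋ 0`), so the global function and its derivative have two-sided punctured limits
(the values of the per-place `C¹` function of the partial orbital lambda).  Used where `τ·D_{G∕H}` does NOT vanish at the wall (the `H`-wall `z₀ = z₂` at a definite place).

SETTING (★ (δ)∕(C-bdry-glob) verbatim).  `G′_∞ = U(diag α)(L⁺ ⊗ ℝ) ≃ₜ* Π_v G_v` (★ `archPiEquivCM`), per-place Haar measures `ν_v`, `ν_∞ = e⁻¹_*(⊗ ν_v)`; a place `w`; a global torus
point `z` regular at every `v ≠ w` with `z w 0 = z w 2 ≠ z w 1`; the global one-angle curve `z^ψ = update z w (i ↦ z w i · e^{i(1,0,−1)_i ψ})`; a relabelling `ρ : W → S₃` whose `w`-wall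
is COMPACT (`0 < re σ_w(α_{ρ_w⁻¹0})·re σ_w(α_{ρ_w⁻¹2})`); an ambient-smooth `Θ : M₃(L ⊗ ℝ) → ℂ` compactly supported on the group.

WHAT IS PROVED.
* `exists_tendsto_integral_comp_conj_splitCurve_comp_perm_of_pos` — PER PLACE, relabelled partner `ρ` with compact `w`-wall: `O_ρ(ψ) = ∫_{G_w} Θ(↑↑(x·diag(z_ψ∘ρ)·x⁻¹)) dν` and
  `O_ρ′` have limits `A, B` as `ψ → 0` (★ (J-cw) `C¹` on the block-separated set, after ★ `integral_comp_conj_circleDiagonal_comp_perm_eq_integral_ambient'`);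
* **`exists_tendsto_integral_comp_conj_archDiagTorus_update_splitCurve_comp_of_pos`** — GLOBAL: `∫_{G′_∞} Θ(↑↑(g·t((z^ψ)∘ρ)·g⁻¹)) dν_∞ → A` and its derivative `→ B` along the
  punctured neighbourhood `ψ → 0, ψ ≠ 0` (★ (δ) §2 Fubini identity on the open regular set + ★ `exists_contDiff_partialOrbital_eq`).
HONEST LABEL: HC_CM is proved only modulo the 7 printed citations (2 remaining: hLiu418 = stmt-HodgeConjecture-24832, h413 = stmt-HodgeConjecture-24833) until rung 0 closes; kit for (M2-01),
pays nothing by itself.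

## References
* [Rogawski1990] J. D. Rogawski, *Automorphic Representations of Unitary Groups in Three Variables*, Ann. of Math. Stud. 123 (1990), §8.2 pp. 119, 122–124.
* [Varadarajan1989] V. S. Varadarajan, *An Introduction to Harmonic Analysis on Semisimple Lie Groups* (1989), §6.4 Thm 18, Thm 20.
* [BorelJacquet1979] A. Borel, H. Jacquet, *Automorphic forms and automorphic representations*, PSPM 33.1 (1979), §4.1.
-/

set_option autoImplicit false

noncomputable section

open MeasureTheory Measure Filter Topology NumberField NumberField.InfinitePlace NumberField.mixedEmbedding Equiv Function Set
open Literature.MeasureTheory.Group Literature.NumberTheory.Automorphic Literature.NumberTheory.Automorphic.UnitaryGroup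
open Literature.LinearAlgebra.Matrix
open scoped Matrix MatrixGroups Matrix.Norms.Operator ContDiff

namespace Literature.NumberTheory.Rogawski1990

section Local

variable (L : Type) [Field L] (α : Fin 3 → L) (w : {w : InfinitePlace L // IsComplex w})
  [MeasurableSpace (GL (Fin 3) ℂ)] [BorelSpace (GL (Fin 3) ℂ)]

/-- **PER PLACE, RELABELLED PARTNER `ρ`, COMPACT WALL, BARE FUNCTION**: for `O_ρ(ψ) = ∫_{G_w} Θ(↑↑(x·diag(z_ψ ∘ ρ)·x⁻¹)) dν` with `z₀ 0 = z₀ 2 ≠ z₀ 1` and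
`0 < re σ_w(α_{ρ⁻¹0})·re σ_w(α_{ρ⁻¹2})` there are `A B` with `O_ρ → A` and `O_ρ′ → B` as `ψ → 0` (the function is `C¹` through `0`, ★ (J-cw), after transport to `G_w(α∘ρ⁻¹)`).
[cite: Rogawski1990, §8.2 p. 123] [cite: Varadarajan1989, §2.4 Thm. 8] -/
theorem exists_tendsto_integral_comp_conj_splitCurve_comp_perm_of_pos (hα : ∀ i, α i ≠ 0) (hreal : ∀ i, (w.1.embedding (α i)).im = 0)
    (ν : Measure (archLocal L 3 (Matrix.diagonal α) w)) [ν.IsHaarMeasure]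
    (Θ : Matrix (Fin 3) (Fin 3) ℂ → ℂ) (hΘ : ContDiff ℝ (⊤ : ℕ∞) Θ)
    (hΘc : HasCompactSupport fun k : archLocal L 3 (Matrix.diagonal α) w => Θ (((k : GL (Fin 3) ℂ) : Matrix (Fin 3) (Fin 3) ℂ)))
    (z₀ : Fin 3 → Circle) (h02 : z₀ 0 = z₀ 2) (h01 : z₀ 0 ≠ z₀ 1) (ρ : Perm (Fin 3))
    (hpos : 0 < (w.1.embedding (α (ρ⁻¹ 0))).re * (w.1.embedding (α (ρ⁻¹ 2))).re) :
    ∃ A B : ℂ,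
      Tendsto (fun ψ : ℝ => ∫ g : archLocal L 3 (Matrix.diagonal α) w,
        Θ ((((g * ⟨circleDiagonal 3 ((fun i => z₀ i * Circle.exp (![(1 : ℝ), 0, -1] i * ψ)) ∘ ⇑ρ), circleDiagonal_mem_archLocal_diagonal L 3 α w _⟩ * g⁻¹ :
          archLocal L 3 (Matrix.diagonal α) w) : GL (Fin 3) ℂ) : Matrix (Fin 3) (Fin 3) ℂ)) ∂ν) (𝓝 0) (𝓝 A) ∧
      Tendsto (fun ψ : ℝ => deriv (fun ψ : ℝ => ∫ g : archLocal L 3 (Matrix.diagonal α) w,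
        Θ ((((g * ⟨circleDiagonal 3 ((fun i => z₀ i * Circle.exp (![(1 : ℝ), 0, -1] i * ψ)) ∘ ⇑ρ), circleDiagonal_mem_archLocal_diagonal L 3 α w _⟩ * g⁻¹ :
          archLocal L 3 (Matrix.diagonal α) w) : GL (Fin 3) ℂ) : Matrix (Fin 3) (Fin 3) ℂ)) ∂ν) ψ) (𝓝 0) (𝓝 B) := by
  classical
  have hα' : ∀ i, (α ∘ ⇑ρ⁻¹) i ≠ 0 := fun i => hα (ρ⁻¹ i)
  have hreal' : ∀ i, (w.1.embedding ((α ∘ ⇑ρ⁻¹) i)).im = 0 := fun i => hreal (ρ⁻¹ i)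
  haveI : LocallyCompactSpace (archLocal L 3 (Matrix.diagonal (α ∘ ⇑ρ⁻¹)) w) := locallyCompactSpace_archLocal L 3 _ w
  haveI : SecondCountableTopology (archLocal L 3 (Matrix.diagonal (α ∘ ⇑ρ⁻¹)) w) := secondCountableTopology_archLocal L 3 _ w
  set ν' : Measure (archLocal L 3 (Matrix.diagonal (α ∘ ⇑ρ⁻¹)) w) :=
    ν.map (ContinuousMulEquiv.restrictSubgroup (GLn.conjEquiv (Matrix.GeneralLinearGroup.mkOfDetNeZero _ (det_monomial_one_ne_zero 3 ρ⁻¹)))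
      (archLocal L 3 (Matrix.diagonal (α ∘ ⇑ρ⁻¹)) w) (archLocal L 3 (Matrix.diagonal α) w) (mem_archLocal_comp_perm_iff_conj_mem L 3 α w ρ⁻¹)).symm with hν'
  haveI : ν'.IsHaarMeasure := ContinuousMulEquiv.isHaarMeasure_map ν _
  set Θ' : Matrix (Fin 3) (Fin 3) ℂ → ℂ := fun A => Θ ((monomial ρ⁻¹ fun _ : Fin 3 => (1 : ℂ)) * A *
      (((Matrix.GeneralLinearGroup.mkOfDetNeZero _ (det_monomial_one_ne_zero 3 ρ⁻¹))⁻¹ : GL (Fin 3) ℂ) : Matrix (Fin 3) (Fin 3) ℂ)) with hΘ'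
  have hΘ's : ContDiff ℝ (⊤ : ℕ∞) Θ' := contDiff_comp_monomial_conj 3 ρ⁻¹ Θ hΘ
  have hΘ'1 : ContDiff ℝ 1 Θ' := hΘ's.of_le (by exact_mod_cast le_top)
  have hΘ'c : HasCompactSupport fun k : archLocal L 3 (Matrix.diagonal (α ∘ ⇑ρ⁻¹)) w => Θ' (((k : GL (Fin 3) ℂ) : Matrix (Fin 3) (Fin 3) ℂ)) :=
    hasCompactSupport_comp_relabel L 3 α w ρ⁻¹ Θ hΘc
  have h12 : z₀ 1 ≠ z₀ 2 := fun h => h01 (h02.trans h.symm)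
  -- transport to the standard curve on the relabelled group (★ `integral_comp_conj_circleDiagonal_comp_perm_eq_integral_ambient'`)
  have hfun : (fun ψ : ℝ => ∫ g : archLocal L 3 (Matrix.diagonal α) w,
        Θ ((((g * ⟨circleDiagonal 3 ((fun i => z₀ i * Circle.exp (![(1 : ℝ), 0, -1] i * ψ)) ∘ ⇑ρ), circleDiagonal_mem_archLocal_diagonal L 3 α w _⟩ * g⁻¹ :
          archLocal L 3 (Matrix.diagonal α) w) : GL (Fin 3) ℂ) : Matrix (Fin 3) (Fin 3) ℂ)) ∂ν) =
      fun ψ : ℝ => ∫ g' : archLocal L 3 (Matrix.diagonal (α ∘ ⇑ρ⁻¹)) w,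
        Θ' ((((g' * ⟨circleDiagonal 3 (fun i => z₀ i * Circle.exp (![(1 : ℝ), 0, -1] i * ψ)), circleDiagonal_mem_archLocal_diagonal L 3 (α ∘ ⇑ρ⁻¹) w _⟩ * g'⁻¹ :
          archLocal L 3 (Matrix.diagonal (α ∘ ⇑ρ⁻¹)) w) : GL (Fin 3) ℂ) : Matrix (Fin 3) (Fin 3) ℂ)) ∂ν' := by
    funext ψ
    exact integral_comp_conj_circleDiagonal_comp_perm_eq_integral_ambient' L 3 α w ρ ν Θ _
  rw [hfun]
  -- ★ (J-cw): `C¹` on the open block-separated set `U ∋ 0`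
  have hU := isOpen_setOf_splitCurve_blockSeparated z₀
  have h0U : (0 : ℝ) ∈ {ψ : ℝ | ∀ i j : Fin 3, (![(0 : ℕ), 1, 0]) i ≠ (![(0 : ℕ), 1, 0]) j →
      z₀ i * Circle.exp (![(1 : ℝ), 0, -1] i * ψ) ≠ z₀ j * Circle.exp (![(1 : ℝ), 0, -1] j * ψ)} := splitCurve_blockSeparated_zero h01 h12
  have hC1 := contDiffOn_one_integral_comp_conj_splitCurve_compactWall L (α ∘ ⇑ρ⁻¹) w ν' hα' hreal' hpos Θ' hΘ'1 hΘ'c z₀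
  exact ⟨_, _, (hC1.continuousOn.continuousAt (hU.mem_nhds h0U)).tendsto,
    ((hC1.continuousOn_deriv_of_isOpen hU le_rfl).continuousAt (hU.mem_nhds h0U)).tendsto⟩

end Local

section Global

variable (L : Type) [Field L] [NumberField L] [IsCMField L] (α : Fin 3 → L) (w : {w : InfinitePlace L // IsComplex w})
  [MeasurableSpace (GL (Fin 3) ℂ)] [BorelSpace (GL (Fin 3) ℂ)]
  [MeasurableSpace (arch (↥(maximalRealSubfield L)) L (IsCMField.complexConj L) 3 (Matrix.diagonal α))] [BorelSpace (arch (↥(maximalRealSubfield L)) L (IsCMField.complexConj L) 3 (Matrix.diagonal α))]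

open scoped Classical in
/-- **GLOBAL, COMPACT WALL, BARE FUNCTION**: with the `w`-wall of `ρ` compact, `O(ψ) = ∫_{G′_∞} Θ(↑↑(g·t((z^ψ)∘ρ)·g⁻¹)) dν_∞ → A` and `O′ → B` (some `A B : ℂ`) as `ψ → 0`,
`ψ ≠ 0`: the orbital function itself is `C¹` across a compact wall along the normal curve. [cite: Rogawski1990, §8.2 p. 123] [cite: Varadarajan1989, §2.4 Thm. 8] [cite: BorelJacquet1979, §4.1] -/
theorem exists_tendsto_integral_comp_conj_archDiagTorus_update_splitCurve_comp_of_pos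
    (νw : ∀ v : {w : InfinitePlace L // IsComplex w}, Measure (archLocal L 3 (Matrix.diagonal α) v)) [∀ v, (νw v).IsHaarMeasure]
    (hα : ∀ i, α i ≠ 0) (hherm : ∀ i, (IsCMField.complexConj L (α i) : L) = α i)
    (Θ : Matrix (Fin 3) (Fin 3) (mixedSpace L) → ℂ) (hΘ : ContDiff ℝ (⊤ : ℕ∞) Θ)
    (hΘc : HasCompactSupport fun g : arch (↥(maximalRealSubfield L)) L (IsCMField.complexConj L) 3 (Matrix.diagonal α) => Θ ((g : GL (Fin 3) (mixedSpace L)) : Matrix (Fin 3) (Fin 3) (mixedSpace L)))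
    (z : {w : InfinitePlace L // IsComplex w} → Fin 3 → Circle) (hz : ∀ v, v ≠ w → Function.Injective (z v)) (h02 : z w 0 = z w 2) (h01 : z w 0 ≠ z w 1)
    (ρ : {w : InfinitePlace L // IsComplex w} → Perm (Fin 3))
    (hpos : 0 < (w.1.embedding (α ((ρ w)⁻¹ 0))).re * (w.1.embedding (α ((ρ w)⁻¹ 2))).re) :
    ∃ A B : ℂ,
      Tendsto (fun ψ : ℝ =>
          ∫ g, Θ (((g * archDiagTorus L 3 α (fun v => Function.update z w (fun i => z w i * Circle.exp (![(1 : ℝ), 0, -1] i * ψ)) v ∘ ⇑(ρ v)) * g⁻¹ :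
            arch (↥(maximalRealSubfield L)) L (IsCMField.complexConj L) 3 (Matrix.diagonal α)) : GL (Fin 3) (mixedSpace L)) : Matrix (Fin 3) (Fin 3) (mixedSpace L))
            ∂((Measure.pi νw).map (archPiEquivCM 3 L (Matrix.diagonal α)).symm)) (𝓝[≠] 0) (𝓝 A) ∧
      Tendsto (fun ψ : ℝ => deriv (fun ψ : ℝ =>
          ∫ g, Θ (((g * archDiagTorus L 3 α (fun v => Function.update z w (fun i => z w i * Circle.exp (![(1 : ℝ), 0, -1] i * ψ)) v ∘ ⇑(ρ v)) * g⁻¹ :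
            arch (↥(maximalRealSubfield L)) L (IsCMField.complexConj L) 3 (Matrix.diagonal α)) : GL (Fin 3) (mixedSpace L)) : Matrix (Fin 3) (Fin 3) (mixedSpace L))
            ∂((Measure.pi νw).map (archPiEquivCM 3 L (Matrix.diagonal α)).symm)) ψ) (𝓝[≠] 0) (𝓝 B) := by
  have hreal : ∀ i, (w.1.embedding (α i)).im = 0 := fun i => im_embedding_eq_zero_of_complexConj_eq L w (hherm i)
  haveI : ∀ v : {w : InfinitePlace L // IsComplex w}, LocallyCompactSpace (archLocal L 3 (Matrix.diagonal α) v) := fun v => locallyCompactSpace_archLocal L 3 (Matrix.diagonal α) v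
  haveI : ∀ v : {w : InfinitePlace L // IsComplex w}, SecondCountableTopology (archLocal L 3 (Matrix.diagonal α) v) := fun v => secondCountableTopology_archLocal L 3 (Matrix.diagonal α) v
  -- the partial orbital lambda over the places `v ≠ w` at the relabelled base `(z_v ∘ ρ_v)_v` is an ambient-smooth test function `Θ′` on `G_w`
  obtain ⟨Θ', hΘ', hΘ'c, hΘ'eq⟩ := exists_contDiff_partialOrbital_eq L 3 α νw hα w Θ hΘ hΘc (z := fun v => z v ∘ ⇑(ρ v))
    (fun v hv => (hz v hv).comp (ρ v).injective)
  -- the per-place function at `w`: its value and derivative limits (this file, per place)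
  obtain ⟨A, B, hA, hB⟩ := exists_tendsto_integral_comp_conj_splitCurve_comp_perm_of_pos L α w hα hreal (νw w) Θ' hΘ' hΘ'c (z w) h02 h01 (ρ w) hpos
  -- the open set of regular parameters at `w`, a punctured neighbourhood of `0`
  set T : Set ℝ := {ψ | Function.Injective fun i => z w i * Circle.exp (![(1 : ℝ), 0, -1] i * ψ)} with hT
  have hTopen : IsOpen T := isOpen_setOf_injective.preimage (continuous_torusCurve (z w) ![(1 : ℝ), 0, -1])
  have hTev : ∀ᶠ ψ in 𝓝[≠] (0 : ℝ), ψ ∈ T := eventually_injective_splitCurve (z w) h02 h01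
  -- on `T` the global function IS the per-place one
  have heq : ∀ ψ ∈ T,
      ∫ g, Θ (((g * archDiagTorus L 3 α (fun v => Function.update z w (fun i => z w i * Circle.exp (![(1 : ℝ), 0, -1] i * ψ)) v ∘ ⇑(ρ v)) * g⁻¹ :
        arch (↥(maximalRealSubfield L)) L (IsCMField.complexConj L) 3 (Matrix.diagonal α)) : GL (Fin 3) (mixedSpace L)) : Matrix (Fin 3) (Fin 3) (mixedSpace L))
        ∂((Measure.pi νw).map (archPiEquivCM 3 L (Matrix.diagonal α)).symm) =
      ∫ g : archLocal L 3 (Matrix.diagonal α) w,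
        Θ' ((((g * ⟨circleDiagonal 3 ((fun i => z w i * Circle.exp (![(1 : ℝ), 0, -1] i * ψ)) ∘ ⇑(ρ w)), circleDiagonal_mem_archLocal_diagonal L 3 α w _⟩ * g⁻¹ :
          archLocal L 3 (Matrix.diagonal α) w) : GL (Fin 3) ℂ) : Matrix (Fin 3) (Fin 3) ℂ)) ∂(νw w) := by
    intro ψ hψ
    have hreg : ∀ v, Function.Injective (Function.update z w (fun i => z w i * Circle.exp (![(1 : ℝ), 0, -1] i * ψ)) v ∘ ⇑(ρ v)) := by
      intro v
      by_cases hv : v = w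
      · subst hv; rw [Function.update_self]; exact (show Function.Injective _ from hψ).comp (ρ v).injective
      · rw [Function.update_of_ne hv]; exact (hz v hv).comp (ρ v).injective
    rw [integral_comp_conj_archDiagTorus_update_comp_eq_integral_partial L α w νw hα Θ hΘ.continuous hΘc z _ ρ hreg]
    refine integral_congr_ae (Eventually.of_forall fun x => ?_)
    exact (hΘ'eq _).symm
  have hEv : ∀ᶠ ψ in 𝓝[≠] (0 : ℝ),
      ∫ g, Θ (((g * archDiagTorus L 3 α (fun v => Function.update z w (fun i => z w i * Circle.exp (![(1 : ℝ), 0, -1] i * ψ)) v ∘ ⇑(ρ v)) * g⁻¹ :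
        arch (↥(maximalRealSubfield L)) L (IsCMField.complexConj L) 3 (Matrix.diagonal α)) : GL (Fin 3) (mixedSpace L)) : Matrix (Fin 3) (Fin 3) (mixedSpace L))
        ∂((Measure.pi νw).map (archPiEquivCM 3 L (Matrix.diagonal α)).symm) =
      ∫ g : archLocal L 3 (Matrix.diagonal α) w,
        Θ' ((((g * ⟨circleDiagonal 3 ((fun i => z w i * Circle.exp (![(1 : ℝ), 0, -1] i * ψ)) ∘ ⇑(ρ w)), circleDiagonal_mem_archLocal_diagonal L 3 α w _⟩ * g⁻¹ :
          archLocal L 3 (Matrix.diagonal α) w) : GL (Fin 3) ℂ) : Matrix (Fin 3) (Fin 3) ℂ)) ∂(νw w) := hTev.mono heq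
  -- the derivatives agree on the open set `T`
  have hDev : ∀ᶠ ψ in 𝓝[≠] (0 : ℝ), deriv (fun ψ : ℝ =>
      ∫ g, Θ (((g * archDiagTorus L 3 α (fun v => Function.update z w (fun i => z w i * Circle.exp (![(1 : ℝ), 0, -1] i * ψ)) v ∘ ⇑(ρ v)) * g⁻¹ :
        arch (↥(maximalRealSubfield L)) L (IsCMField.complexConj L) 3 (Matrix.diagonal α)) : GL (Fin 3) (mixedSpace L)) : Matrix (Fin 3) (Fin 3) (mixedSpace L))
        ∂((Measure.pi νw).map (archPiEquivCM 3 L (Matrix.diagonal α)).symm)) ψ =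
      deriv (fun ψ : ℝ => ∫ g : archLocal L 3 (Matrix.diagonal α) w,
        Θ' ((((g * ⟨circleDiagonal 3 ((fun i => z w i * Circle.exp (![(1 : ℝ), 0, -1] i * ψ)) ∘ ⇑(ρ w)), circleDiagonal_mem_archLocal_diagonal L 3 α w _⟩ * g⁻¹ :
          archLocal L 3 (Matrix.diagonal α) w) : GL (Fin 3) ℂ) : Matrix (Fin 3) (Fin 3) ℂ)) ∂(νw w)) ψ := by
    refine hTev.mono fun ψ hψ => Filter.EventuallyEq.deriv_eq ?_
    exact Filter.eventually_of_mem (hTopen.mem_nhds hψ) fun ψ' hψ' => heq ψ' hψ'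
  exact ⟨A, B, (tendsto_nhdsWithin_of_tendsto_nhds hA).congr' (hEv.mono fun _ h => h.symm), (tendsto_nhdsWithin_of_tendsto_nhds hB).congr' (hDev.mono fun _ h => h.symm)⟩

end Global

end Literature.NumberTheory.Rogawski1990

end
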